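import Literature.Analysis.Complex.PositiveForms
import HarnessLib

/-!
# A `(p,p)`-form is determined by its values on complex frames; positive forms are real

Topic `Literature/Analysis/Complex`; lane `lit-hodgefound` (Track 2 foundations library), prover
seat `lit-hodgefound-p06`, self-claimed row g24-#4; sequel of `PositiveForms.lean` (Demailly,
*Complex Analytic and Differential Geometry*, Ch. III §1.A, pointwise).

Demailly's Corollary III.1.5 — **all positive `(p,p)`-forms are real** — is proved in
`PositiveForms.lean` only for `p = 1` (and there "positive" is Criterion III.1.6: `u ≥ 0` on the
complex frames `(v₁, I v₁, …, v_p, I v_p)`). Here it is proved for every `p`, through the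
following uniqueness principle, which is the linear-algebra content of Demailly's Lemma III.1.4 /
Criterion III.1.6 ("a `(p,p)`-form is known once its restrictions to complex `p`-planes are"):

* `IsOfTypeAt.eq_zero_of_forall_apply_complexFrame` — **a form of type `(p,p)` that vanishes on
  every complex frame `(v₁, I v₁, …, v_p, I v_p)` is zero**; hence two `(p,p)`-forms with the same
  values on complex frames are equal (`IsOfTypeAt.eq_of_forall_apply_complexFrame_eq`).
  Proof (polarization, by induction on `p`): contracting a `(p+1,p+1)`-form with `(a, I a)` gives a
  `(p,p)`-form (`isOfTypeAt_curry_curry`), so by induction the form vanishes on every tuple two of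
  whose slots carry `(a, I a)`; polarizing the real quadratic form `a ↦ u(…, a, …, I a, …)` this says
  that moving the factor `I` from one slot to another does not change the value and that two factors
  `I` change the sign; then all `2p+2` slots rotate together like `e^{±i(2p+2)θ}`, which contradicts
  the weight `0` of a `(p+1,p+1)`-form at `θ = π/(2p+2)` unless the form is `0`.
* `IsOfTypeAt.conjForm_eq_of_forall_im_eq_zero` — a `(p,p)`-form with real values on complex frames
  is real (`ū = u`); **`IsPositive.conjForm_eq_of_isOfTypeAt` — positive `(p,p)`-forms are real**
  (Demailly, Cor. III.1.5, all `p`); `IsPositive.eq_zero_of_neg` — the cone of positive `(p,p)`-forms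
  is salient (`u` and `-u` positive `⇒ u = 0`).

Theorems only; no new definitions besides private abbreviations, no named facts.

## References

* [DemaillyAGBook] J.-P. Demailly, *Complex Analytic and Differential Geometry* (version of June 21,
  2012), Ch. III §1.A, Lemma 1.4, Cor. 1.5, Criterion 1.6.
* [Voisin2002] C. Voisin, *Hodge Theory and Complex Algebraic Geometry I* (2002), §2.3.1.
-/

noncomputable section

open scoped ComplexOrder ComplexConjugate
open Complex Function ContinuousAlternatingMap
open Literature.LinearAlgebra.Alternating (conjForm conjForm_apply)

namespace Literature.Analysis.Complex.PositiveForm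

variable {V : Type*} [NormedAddCommGroup V] [NormedSpace ℂ V] {m n p : ℕ}

/-! ### Two-slot calculus -/

section TwoSlot

variable (u : V [⋀^Fin m]→L[ℝ] ℂ) {i j : Fin m}

/-- Additivity in the inner of two updated slots. [folklore] -/
private theorem upd₂_add_left (hij : i ≠ j) (x : Fin m → V) (c c' d : V) :
    u (update (update x i (c + c')) j d) =
      u (update (update x i c) j d) + u (update (update x i c') j d) := by
  simp only [update_comm hij]
  exact u.map_update_add _ i c c'

/-- Real homogeneity in the inner of two updated slots. [folklore] -/
private theorem upd₂_smul_left (hij : i ≠ j) (x : Fin m → V) (r : ℝ) (c d : V) :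
    u (update (update x i (r • c)) j d) = r • u (update (update x i c) j d) := by
  simp only [update_comm hij]
  exact u.map_update_smul _ i r c

/-- Negation in the inner of two updated slots. [folklore] -/
private theorem upd₂_neg_left (hij : i ≠ j) (x : Fin m → V) (c d : V) :
    u (update (update x i (-c)) j d) = -u (update (update x i c) j d) := by
  rw [← neg_one_smul ℝ c, upd₂_smul_left u hij, neg_one_smul]

/-- Alternation across two updated slots: `u(…c…d…) = -u(…d…c…)`. [folklore] -/
private theorem upd₂_swap (hij : i ≠ j) (x : Fin m → V) (c d : V) :
    u (update (update x i c) j d) = -u (update (update x i d) j c) := by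
  have h0 : ∀ e : V, u (update (update x i e) j e) = 0 := fun e ↦
    u.map_eq_zero_of_eq _ (by simp [hij]) hij
  have := h0 (c + d)
  rw [upd₂_add_left u hij, u.map_update_add, u.map_update_add, h0, h0, zero_add, add_zero] at this
  exact eq_neg_of_add_eq_zero_left this

/-- **Polarization.** If `u` vanishes whenever slots `i, j` carry `(a, I a)`, then the factor `I`
may be moved between the two slots: `u(…a…Ib…) = u(…Ia…b…)`. [cite: DemaillyAGBook, Ch. III Lemma 1.4] -/
private theorem upd₂_I_right_eq (hij : i ≠ j) (hN : ∀ z : Fin m → V, z j = I • z i → u z = 0)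
    (x : Fin m → V) (a b : V) :
    u (update (update x i a) j (I • b)) = u (update (update x i (I • a)) j b) := by
  have hI : ∀ c : V, u (update (update x i c) j (I • c)) = 0 := fun c ↦
    hN _ (by simp [hij])
  have := hI (a + b)
  rw [smul_add, upd₂_add_left u hij, u.map_update_add, u.map_update_add, hI, hI, zero_add,
    add_zero] at this
  -- `u(a, Ib) + u(b, Ia) = 0` and `u(b, Ia) = -u(Ia, b)`
  rw [upd₂_swap u hij x b (I • a)] at this
  linear_combination this

/-- … and two factors `I` change the sign: `u(…Ia…Ib…) = -u(…a…b…)`. [cite: DemaillyAGBook, Ch. III Lemma 1.4] -/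
private theorem upd₂_I_I (hij : i ≠ j) (hN : ∀ z : Fin m → V, z j = I • z i → u z = 0)
    (x : Fin m → V) (a b : V) :
    u (update (update x i (I • a)) j (I • b)) = -u (update (update x i a) j b) := by
  rw [upd₂_I_right_eq u hij hN, smul_smul, I_mul_I, neg_one_smul, upd₂_neg_left u hij]

end TwoSlot

/-! ### The step: weight zero and vanishing on `(a, I a, …)` force `u = 0` -/

section Step

/-- Rotation of one slot by `I`. [folklore] -/
private def rot (t : Fin m) (x : Fin m → V) : Fin m → V := update x t (I • x t)

/-- The rotated slot. [folklore] -/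
private theorem rot_apply_self (t : Fin m) (x : Fin m → V) : rot t x t = I • x t := update_self ..

/-- The other slots are unchanged. [folklore] -/
private theorem rot_apply_of_ne {t k : Fin m} (h : k ≠ t) (x : Fin m → V) : rot t x k = x k :=
  update_of_ne h ..

/-- Rotations of distinct slots commute. [folklore] -/
private theorem rot_comm {s t : Fin m} (h : s ≠ t) (x : Fin m → V) : rot s (rot t x) = rot t (rot s x) := by
  unfold rot
  rw [update_of_ne h, update_of_ne h.symm, update_comm h]

/-- Decomposition of a complex scalar in one slot: `u(…, c v, …) = Re c · u(…, v, …) + Im c · u(…, I v, …)`.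
[folklore] -/
private theorem map_update_complex_smul (u : V [⋀^Fin m]→L[ℝ] ℂ) (y : Fin m → V) (t : Fin m)
    (c : ℂ) (v : V) :
    u (update y t (c • v)) = c.re * u (update y t v) + c.im * u (update y t (I • v)) := by
  have hc : c • v = (c.re : ℝ) • v + (c.im : ℝ) • (I • v) := by
    rw [← Complex.coe_smul, ← Complex.coe_smul, smul_smul, ← add_smul, Complex.re_add_im]
  rw [hc, u.map_update_add, u.map_update_smul, u.map_update_smul, Complex.real_smul,
    Complex.real_smul]

variable (u : V [⋀^Fin (n + 2)]→L[ℝ] ℂ)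
  (hN : ∀ z : Fin (n + 2) → V, z 1 = I • z 0 → u z = 0)
include hN

/-- From slots `(0, 1)` to slots `(0, t)` by alternation. [folklore] -/
private theorem hN_of_ne {t : Fin (n + 2)} (ht : t ≠ 0) (z : Fin (n + 2) → V) (hz : z t = I • z 0) :
    u z = 0 := by
  by_cases ht1 : t = 1
  · subst ht1; exact hN z hz
  have h10 : (1 : Fin (n + 2)) ≠ t := fun h ↦ ht1 h.symm
  have hswap : u (z ∘ Equiv.swap 1 t) = -u z := u.map_swap z h10
  have h0 : u (z ∘ Equiv.swap 1 t) = 0 := hN _ (by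
    simp only [comp_apply, Equiv.swap_apply_left]
    rw [Equiv.swap_apply_of_ne_of_ne (by simp) (Ne.symm ht), hz])
  rw [h0] at hswap
  exact neg_eq_zero.1 hswap.symm

/-- One factor `I` in any slot gives the same value as in slot `0`. [cite: DemaillyAGBook, Ch. III Lemma 1.4] -/
private theorem apply_rot_eq (t : Fin (n + 2)) (x : Fin (n + 2) → V) : u (rot t x) = u (rot 0 x) := by
  by_cases ht : t = 0
  · rw [ht]
  have h0t : (0 : Fin (n + 2)) ≠ t := Ne.symm ht
  have := upd₂_I_right_eq u h0t (fun z hz ↦ hN_of_ne u hN ht z hz) x (x 0) (x t)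
  rwa [update_eq_self, update_comm h0t, update_eq_self] at this

/-- Two factors `I` (slot `0` and slot `t`) change the sign. [cite: DemaillyAGBook, Ch. III Lemma 1.4] -/
private theorem apply_rot_rot_eq (t : Fin (n + 2)) (x : Fin (n + 2) → V) :
    u (rot 0 (rot t x)) = -u x := by
  by_cases ht : t = 0
  · subst ht
    unfold rot
    rw [update_self, update_idem, smul_smul, I_mul_I, neg_one_smul, ← neg_one_smul ℝ (x 0),
      u.map_update_smul, update_eq_self, neg_one_smul]
  have h0t : (0 : Fin (n + 2)) ≠ t := Ne.symm ht
  have := upd₂_I_I u h0t (fun z hz ↦ hN_of_ne u hN ht z hz) x (x 0) (x t)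
  rw [update_eq_self, update_eq_self] at this
  rw [← this, rot_comm h0t]
  unfold rot
  rw [update_of_ne ht]

/-- Scaling the first `t` slots by `c`. [folklore] -/
private def scaleUpTo (c : ℂ) (t : ℕ) (x : Fin (n + 2) → V) : Fin (n + 2) → V :=
  fun k ↦ if (k : ℕ) < t then c • x k else x k

omit hN in
/-- Scaling no slot. [folklore] -/
private theorem scaleUpTo_zero (c : ℂ) (x : Fin (n + 2) → V) : scaleUpTo c 0 x = x := by
  funext k; simp [scaleUpTo]

omit hN in
/-- Scaling every slot. [folklore] -/
private theorem scaleUpTo_all (c : ℂ) (x : Fin (n + 2) → V) :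
    scaleUpTo c (n + 2) x = fun k ↦ c • x k := by
  funext k; simp [scaleUpTo, k.2]

omit hN in
/-- Scaling one more slot is an update. [folklore] -/
private theorem scaleUpTo_succ (c : ℂ) {t : ℕ} (ht : t < n + 2) (x : Fin (n + 2) → V) :
    scaleUpTo c (t + 1) x =
      update (scaleUpTo c t x) ⟨t, ht⟩ (c • scaleUpTo c t x ⟨t, ht⟩) := by
  funext k
  by_cases hk : k = ⟨t, ht⟩
  · subst hk; simp [scaleUpTo]
  · have hkt : (k : ℕ) ≠ t := fun h ↦ hk (Fin.ext h)
    rw [update_of_ne hk]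
    simp only [scaleUpTo]
    have : ((k : ℕ) < t + 1) ↔ ((k : ℕ) < t) := by omega
    simp only [this]

/-- **The pair `(u, u ∘ rot₀)` rotates**: scaling the first `t` slots by `c` acts through
`(Re cᵗ, Im cᵗ)`. [cite: DemaillyAGBook, Ch. III Lemma 1.4] -/
private theorem apply_scaleUpTo (c : ℂ) :
    ∀ (t : ℕ), t ≤ n + 2 → ∀ x : Fin (n + 2) → V,
      u (scaleUpTo c t x) = (c ^ t).re * u x + (c ^ t).im * u (rot 0 x) ∧
        u (rot 0 (scaleUpTo c t x)) = (c ^ t).re * u (rot 0 x) - (c ^ t).im * u x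
  | 0, _, x => by simp [scaleUpTo_zero]
  | t + 1, ht, x => by
    have ht' : t < n + 2 := by omega
    obtain ⟨h₁, h₂⟩ := apply_scaleUpTo c t ht'.le x
    have hre : (c ^ (t + 1)).re = (c ^ t).re * c.re - (c ^ t).im * c.im := by
      rw [pow_succ, Complex.mul_re]
    have him : (c ^ (t + 1)).im = (c ^ t).re * c.im + (c ^ t).im * c.re := by
      rw [pow_succ, Complex.mul_im]
    -- the `u`-part, valid at every point and every slot
    have hA : ∀ (T : Fin (n + 2)) (y : Fin (n + 2) → V),
        u (update y T (c • y T)) = c.re * u y + c.im * u (rot 0 y) := fun T y ↦ by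
      rw [map_update_complex_smul, update_eq_self, ← apply_rot_eq u hN T y]
      rfl
    -- rotating slot `0` commutes with scaling slot `T`
    have hcomm : ∀ (T : Fin (n + 2)) (y : Fin (n + 2) → V),
        rot 0 (update y T (c • y T)) = update (rot 0 y) T (c • rot 0 y T) := fun T y ↦ by
      by_cases h0T : T = 0
      · subst h0T
        unfold rot
        rw [update_self, update_idem, update_self, update_idem, smul_comm]
      · unfold rot
        rw [update_of_ne (Ne.symm h0T), update_of_ne h0T, update_comm h0T]
    refine ⟨?_, ?_⟩
    · rw [scaleUpTo_succ c ht', hA, h₁, h₂, hre, him]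
      push_cast
      ring
    · rw [scaleUpTo_succ c ht', hcomm, hA, apply_rot_rot_eq u hN, h₁, h₂, hre, him]
      push_cast
      ring

/-- **The step.** A form of weight `0` under the simultaneous rotation `x ↦ e^{iθ} x` of all its
`n + 2` arguments which vanishes whenever slots `0, 1` carry `(a, I a)` is zero.
[cite: DemaillyAGBook, Ch. III Lemma 1.4] -/
private theorem eq_zero_of_weight_zero
    (hrot : ∀ (θ : ℝ) (x : Fin (n + 2) → V), u (fun k ↦ exp (θ * I) • x k) = u x) : u = 0 := by
  ext x
  have hn2 : (n : ℂ) + 2 ≠ 0 := by exact_mod_cast (show (n + 2 : ℕ) ≠ 0 by omega)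
  have hcn : exp (↑(Real.pi / (n + 2) : ℝ) * I) ^ (n + 2) = -1 := by
    rw [← Complex.exp_nat_mul, ← Complex.exp_pi_mul_I]
    congr 1
    push_cast
    field_simp
  have h1 := (apply_scaleUpTo u hN (exp (↑(Real.pi / (n + 2) : ℝ) * I)) (n + 2) le_rfl x).1
  rw [scaleUpTo_all, hrot, hcn] at h1
  norm_num at h1
  -- `h1 : u x = -u x`
  rw [ContinuousAlternatingMap.coe_zero, Pi.zero_apply]
  linear_combination h1 / 2

end Step

/-! ### Contraction with `(a, I a)` and the induction -/

section Contraction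

/-- The complex frame of `(a, v₁, …, v_p)` is `(a, I a)` followed by the complex frame of `v`.
[cite: DemaillyAGBook, Ch. III §1.A p. 129] -/
theorem complexFrame_cons (a : V) (v : Fin p → V) :
    complexFrame (Fin.cons a v : Fin (p + 1) → V) =
      (Matrix.vecCons a (Matrix.vecCons (I • a) (complexFrame v)) : Fin (2 * p + 2) → V) := by
  funext k
  obtain ⟨k, hk⟩ := k
  match k, hk with
  | 0, _ => simp [complexFrame]
  | 1, _ => simp [complexFrame]
  | k + 2, hk =>
    have hk' : k < 2 * p := by omega
    have h2 : (k + 2) / 2 = k / 2 + 1 := by omega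
    have hcF : complexFrame v ⟨k, hk'⟩ =
        if Even k then v ⟨k / 2, by omega⟩ else I • v ⟨k / 2, by omega⟩ := rfl
    have : (Matrix.vecCons a (Matrix.vecCons (I • a) (complexFrame v)) : Fin (2 * p + 2) → V)
        ⟨k + 2, hk⟩ = complexFrame v ⟨k, hk'⟩ := rfl
    rw [this, hcF]
    simp only [complexFrame, Nat.even_add, even_two, iff_true, h2]
    rfl

/-- **Contraction with `(a, I a)` lowers the type by `(1,1)`**: if `u` has type `(p+1, p+1)` then
`u(a, I a, ·)` has type `(p,p)` (the line `ℂa` has `|e^{iθ}|² = 1`). [cite: DemaillyAGBook, Ch. III §1.A p. 129] -/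
theorem isOfTypeAt_curry_curry {u : V [⋀^Fin (2 * p + 2)]→L[ℝ] ℂ} (hu : IsOfTypeAt (p + 1) (p + 1) u)
    (a : V) : IsOfTypeAt p p ((u.curryLeft a).curryLeft (I • a)) := by
  refine ⟨(two_mul p).symm, fun θ y ↦ ?_⟩
  have hw : (((p : ℕ) : ℤ) - (p : ℕ) : ℤ) = 0 := sub_self _
  rw [hw, Int.cast_zero, zero_mul, zero_mul, Complex.exp_zero, one_mul, curryLeft_apply_apply,
    curryLeft_apply_apply, curryLeft_apply_apply, curryLeft_apply_apply]
  set e : ℂ := exp (θ * I) with he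
  -- weight zero of `u` on the rotated tuple `(e a, e I a, e y)`
  have h0 := hu.2 θ (Matrix.vecCons a (Matrix.vecCons (I • a) y))
  have hw' : (((p + 1 : ℕ) : ℤ) - (p + 1 : ℕ) : ℤ) = 0 := sub_self _
  rw [hw', Int.cast_zero, zero_mul, zero_mul, Complex.exp_zero, one_mul] at h0
  have hfun : (fun k : Fin (2 * p + 2) ↦ e • (Matrix.vecCons a (Matrix.vecCons (I • a) y) : _ → V) k) =
      Matrix.vecCons (e • a) (Matrix.vecCons (e • (I • a)) (fun k ↦ e • y k)) := by
    funext k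
    refine Fin.cases ?_ (fun k ↦ ?_) k
    · rfl
    · refine Fin.cases ?_ (fun k ↦ ?_) k <;> rfl
  rw [← he, hfun] at h0
  rw [← h0]
  -- `u(e a, e I a, z) = u(a, I a, z)` since `|e|² = 1`
  have hea : e • a = Real.cos θ • a + Real.sin θ • (I • a) := by
    rw [he, ← Complex.coe_smul, ← Complex.coe_smul, smul_smul, ← add_smul, Complex.exp_mul_I,
      ← Complex.ofReal_cos, ← Complex.ofReal_sin]
  have heIa : e • (I • a) = Real.cos θ • (I • a) + (-Real.sin θ) • a := by
    rw [smul_comm, hea, smul_add, smul_comm I (Real.sin θ), smul_smul, I_mul_I, neg_one_smul,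
      smul_neg, neg_smul, smul_comm I (Real.cos θ) a]
  set z : Fin (2 * p) → V := fun k ↦ e • y k
  set b : V := I • a with hb
  have hlin : ∀ c : V, u (Matrix.vecCons (Real.cos θ • a + Real.sin θ • b) (Matrix.vecCons c z)) =
      Real.cos θ • u (Matrix.vecCons a (Matrix.vecCons c z)) +
        Real.sin θ • u (Matrix.vecCons b (Matrix.vecCons c z)) := fun c ↦ by
    rw [u.vecCons_add, u.vecCons_smul, u.vecCons_smul]
  have hlin' : ∀ (c c' : V) (r s : ℝ), u (Matrix.vecCons c (Matrix.vecCons (r • c' + s • a) z)) =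
      r • u (Matrix.vecCons c (Matrix.vecCons c' z)) + s • u (Matrix.vecCons c (Matrix.vecCons a z)) :=
    fun c c' r s ↦ by
    have := (u.curryLeft c).vecCons_add z (r • c') (s • a)
    rw [(u.curryLeft c).vecCons_smul, (u.curryLeft c).vecCons_smul] at this
    simpa only [curryLeft_apply_apply] using this
  have haa : u (Matrix.vecCons a (Matrix.vecCons a z)) = 0 :=
    u.map_eq_zero_of_eq _ (i := 0) (j := 1) rfl (by simp)
  have hbb : u (Matrix.vecCons b (Matrix.vecCons b z)) = 0 :=
    u.map_eq_zero_of_eq _ (i := 0) (j := 1) rfl (by simp)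
  have hba : u (Matrix.vecCons b (Matrix.vecCons a z)) = -u (Matrix.vecCons a (Matrix.vecCons b z)) := by
    have hsw : u (Matrix.vecCons a (Matrix.vecCons b z) ∘ Equiv.swap 0 1) =
        -u (Matrix.vecCons a (Matrix.vecCons b z)) :=
      u.map_swap (Matrix.vecCons a (Matrix.vecCons b z)) (i := 0) (j := 1) (by simp)
    rw [← hsw]
    congr 1
    funext k
    refine Fin.cases ?_ (fun k ↦ ?_) k
    · simp
    · refine Fin.cases ?_ (fun k ↦ ?_) k
      · simp
      · rw [Function.comp_apply,
          Equiv.swap_apply_of_ne_of_ne (Fin.succ_ne_zero _) (Fin.succ_succ_ne_one _)]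
        rfl
  rw [hea, heIa, hlin, hlin', hlin', haa, hbb, hba]
  simp only [Complex.real_smul, Complex.ofReal_neg, mul_zero, add_zero, zero_add]
  have hcs : (Real.cos θ : ℂ) * Real.cos θ + Real.sin θ * Real.sin θ = 1 := by
    rw [← Complex.ofReal_mul, ← Complex.ofReal_mul, ← Complex.ofReal_add, ← sq, ← sq,
      Real.cos_sq_add_sin_sq, Complex.ofReal_one]
  linear_combination (-(u (Matrix.vecCons a (Matrix.vecCons b z)))) * hcs

/-- **A `(p,p)`-form vanishing on all complex frames `(v₁, I v₁, …, v_p, I v_p)` is zero**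
(the uniqueness half of Demailly's Lemma III.1.4 / Criterion III.1.6: a `(p,p)`-form is determined
by its restrictions to complex `p`-planes). [cite: DemaillyAGBook, Ch. III Lemma 1.4 and Criterion 1.6] -/
theorem _root_.Literature.Analysis.Complex.IsOfTypeAt.eq_zero_of_forall_apply_complexFrame :
    ∀ {p : ℕ} {u : V [⋀^Fin (2 * p)]→L[ℝ] ℂ}, IsOfTypeAt p p u →
      (∀ v : Fin p → V, u (complexFrame v) = 0) → u = 0
  | 0, u, _, h => by
    ext x
    have hx : x = complexFrame (V := V) (p := 0) Fin.elim0 := funext fun k ↦ Fin.elim0 k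
    rw [hx, h, ContinuousAlternatingMap.coe_zero, Pi.zero_apply]
  | p + 1, u, hu, h => by
    -- view `u` as a form in `2p + 2` slots
    change V [⋀^Fin (2 * p + 2)]→L[ℝ] ℂ at u
    -- every contraction `u(a, I a, ·)` is a `(p,p)`-form vanishing on complex frames, hence zero
    have hcurry : ∀ a : V, (u.curryLeft a).curryLeft (I • a) = 0 := fun a ↦
      (isOfTypeAt_curry_curry hu a).eq_zero_of_forall_apply_complexFrame fun v ↦ by
        rw [curryLeft_apply_apply, curryLeft_apply_apply, ← complexFrame_cons]
        exact h (Fin.cons a v)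
    refine eq_zero_of_weight_zero u (fun z hz ↦ ?_) (fun θ x ↦ ?_)
    · have hz' : z = Matrix.vecCons (z 0) (Matrix.vecCons (I • z 0) (Fin.tail (Fin.tail z))) := by
        funext k
        refine Fin.cases rfl (fun k ↦ ?_) k
        refine Fin.cases ?_ (fun k ↦ rfl) k
        simpa using hz
      rw [hz', ← curryLeft_apply_apply, ← curryLeft_apply_apply, hcurry]
      rfl
    · have := hu.2 θ x
      have hw : (((p + 1 : ℕ) : ℤ) - (p + 1 : ℕ) : ℤ) = 0 := sub_self _
      rwa [hw, Int.cast_zero, zero_mul, zero_mul, Complex.exp_zero, one_mul] at this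

/-- **Two `(p,p)`-forms with the same values on all complex frames are equal.**
[cite: DemaillyAGBook, Ch. III Lemma 1.4 and Criterion 1.6] -/
theorem _root_.Literature.Analysis.Complex.IsOfTypeAt.eq_of_forall_apply_complexFrame_eq
    {u w : V [⋀^Fin (2 * p)]→L[ℝ] ℂ} (hu : IsOfTypeAt p p u) (hw : IsOfTypeAt p p w)
    (h : ∀ v : Fin p → V, u (complexFrame v) = w (complexFrame v)) : u = w :=
  sub_eq_zero.1 <| (hu.sub hw).eq_zero_of_forall_apply_complexFrame fun v ↦ by
    rw [ContinuousAlternatingMap.sub_apply, h, sub_self]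

end Contraction

/-! ### Reality of positive forms (Demailly, Cor. III.1.5) -/

section Reality

/-- The conjugate of a form of pointwise type `(p,q)` has type `(q,p)` (local copy of the tree's
`isOfTypeAt_conjForm`, whose module imports the complex-torus Hodge–Riemann layer).
[cite: Voisin2002, §2.3.1] -/
private theorem isOfTypeAt_conjForm' {k q : ℕ} {ψ : V [⋀^Fin k]→L[ℝ] ℂ} (h : IsOfTypeAt p q ψ) :
    IsOfTypeAt q p (conjForm ψ) := by
  refine ⟨by rw [add_comm]; exact h.1, fun θ v ↦ ?_⟩
  rw [conjForm_apply, conjForm_apply, h.2 θ v, map_mul, ← Complex.exp_conj]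
  congr 2
  simp only [map_mul, map_intCast, Complex.conj_ofReal, Complex.conj_I]
  push_cast
  ring

/-- **A `(p,p)`-form whose values on complex frames are real is a real form** (`ū = u`).
[cite: DemaillyAGBook, Ch. III Cor. 1.5] -/
theorem _root_.Literature.Analysis.Complex.IsOfTypeAt.conjForm_eq_of_forall_im_eq_zero
    {u : V [⋀^Fin (2 * p)]→L[ℝ] ℂ} (hu : IsOfTypeAt p p u)
    (h : ∀ v : Fin p → V, (u (complexFrame v)).im = 0) : conjForm u = u :=
  (isOfTypeAt_conjForm' hu).eq_of_forall_apply_complexFrame_eq hu fun v ↦ by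
    rw [conjForm_apply]
    exact Complex.conj_eq_iff_im.2 (h v)

/-- **Positive `(p,p)`-forms are real** (Demailly, Cor. III.1.5, every `p`; "positive" in the sense
of Criterion III.1.6, `PositiveForm.IsPositive`). [cite: DemaillyAGBook, Ch. III Cor. 1.5] -/
theorem IsPositive.conjForm_eq_of_isOfTypeAt {u : V [⋀^Fin (2 * p)]→L[ℝ] ℂ} (hpp : IsOfTypeAt p p u)
    (hu : IsPositive p u) : conjForm u = u :=
  hpp.conjForm_eq_of_forall_im_eq_zero fun v ↦ (isPositive_iff_im_re.1 hu v).1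

/-- Pointwise form: `conj (u x) = u x` for a positive `(p,p)`-form and ANY `2p` vectors `x`.
[cite: DemaillyAGBook, Ch. III Cor. 1.5] -/
theorem IsPositive.conj_apply_of_isOfTypeAt {u : V [⋀^Fin (2 * p)]→L[ℝ] ℂ} (hpp : IsOfTypeAt p p u)
    (hu : IsPositive p u) (x : Fin (2 * p) → V) : conj (u x) = u x := by
  have := DFunLike.congr_fun (hu.conjForm_eq_of_isOfTypeAt hpp) x
  rwa [conjForm_apply] at this

/-- **The cone of positive `(p,p)`-forms is salient**: if `u` and `-u` are both positive then
`u = 0`. [cite: DemaillyAGBook, Ch. III (1.3) and Criterion 1.6] -/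
theorem IsPositive.eq_zero_of_neg {u : V [⋀^Fin (2 * p)]→L[ℝ] ℂ} (hpp : IsOfTypeAt p p u)
    (hu : IsPositive p u) (hn : IsPositive p (-u)) : u = 0 :=
  hpp.eq_zero_of_forall_apply_complexFrame fun v ↦
    le_antisymm (neg_nonneg.1 (by simpa using hn v)) (hu v)

/-- Strongly positive forms are determined by complex frames too: a strongly positive `(q,q)`-form
vanishing on all complex frames is zero. [cite: DemaillyAGBook, Ch. III Def. 1.1 and Criterion 1.6] -/
theorem IsStronglyPositive.eq_zero_of_forall_apply_complexFrame {q : ℕ}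
    {u : V [⋀^Fin (2 * q)]→L[ℝ] ℂ} (hu : IsStronglyPositive q u)
    (h : ∀ v : Fin q → V, u (complexFrame v) = 0) : u = 0 :=
  hu.isOfTypeAt.eq_zero_of_forall_apply_complexFrame h

end Reality

end Literature.Analysis.Complex.PositiveForm

end
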